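import Mathlib.GroupTheory.SpecificGroups.Dihedral
import Mathlib.GroupTheory.SpecificGroups.Quaternion
import Literature.Combinatorics.Additive.TripleProductProperty
import Summits.MatrixMultiplication.OmegaCensus.DihedralTPPUpperBound
import Summits.MatrixMultiplication.OmegaCensus.DihedralLikeTPPBound
import HarnessLib

/-!
# No dihedral or dicyclic group beats the sum of the cubes with a single TPP triple

ω-census, family (b3).  Framing: lottery ticket; floor = certified bounds/negative ranges.

A single TPP triple `(S,T,U)` of a finite group `G` yields a non-trivial bound on `ω` through CKSU 2005 Thm 1.8
only if `|S||T||U| > Σᵢ dᵢ³` (sum of the cubes of the character degrees).  For the dihedral group `D_{2n}` the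
character degrees are `1` (`2` resp. `4` of them for `n` odd resp. even) and `2` (`(n−1)/2` resp. `(n−2)/2` of them),
so `Σ d³ = 4n − 2` (`n` odd) or `4n − 4` (`n` even); for the dicyclic group `Q_{4n}` (`n ≥ 2`) they are four `1`'s and
`n − 1` `2`'s, `Σ d³ = 8n − 4`.  The kernel bounds `3|S||T||U| ≤ 8n` (`tpp_volume_le_dihedral`) and
`3|S||T||U| ≤ 16n` (`tpp_volume_le_quaternion`) are below these numbers for every `n ≥ 4` resp. `n ≥ 2`
(and `β(D₆) = 8 < 10`), which we record as explicit arithmetic inequalities: the census sub-family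
"single TPP triples in dihedral / dicyclic groups" is closed for all orders (the character-degree bookkeeping
`Σ d³ = 4n−4, 4n−2, 8n−4` is standard and stays in this docstring; the tree has no character table of `D_{2n}`).
-/

namespace Summit.MatrixMultiplication.OmegaCensus

open Literature.Combinatorics.Additive Finset

/-- For `n ≥ 4` every TPP triple of `D_{2n}` has `|S||T||U| < 4n − 4 ≤ Σ d³(D_{2n})` (`= 4n−4` for even `n`,
`4n−2` for odd `n`). [folklore] -/
theorem tpp_volume_lt_sum_cubes_dihedral {n : ℕ} [NeZero n] (hn : 4 ≤ n) {S T U : Finset (DihedralGroup n)}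
    (h : TripleProductProperty S T U) : S.card * T.card * U.card < 4 * n - 4 := by
  have := tpp_volume_le_dihedral h
  omega

/-- For `n = 3` (`D₆ ≅ S₃`, `Σ d³ = 10`): every TPP triple has `|S||T||U| ≤ 8 < 10`. [folklore] -/
theorem tpp_volume_le_eight_dihedral_three {S T U : Finset (DihedralGroup 3)} (h : TripleProductProperty S T U) :
    S.card * T.card * U.card ≤ 8 := by
  have := tpp_volume_le_dihedral h
  omega

/-- For `n ≥ 2` every TPP triple of the dicyclic group `Q_{4n} = QuaternionGroup n` has
`|S||T||U| < 8n − 4 = Σ d³(Q_{4n})`. [folklore] -/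
theorem tpp_volume_lt_sum_cubes_quaternion {n : ℕ} [NeZero n] (hn : 2 ≤ n) {S T U : Finset (QuaternionGroup n)}
    (h : TripleProductProperty S T U) : S.card * T.card * U.card < 8 * n - 4 := by
  have := tpp_volume_le_quaternion h
  omega

end Summit.MatrixMultiplication.OmegaCensus
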